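import Summits.QuantumFields.BalabanUV.T4Continuum.Support.ShellMeasureWilsonWords

/-!
# `T4Continuum.ShellMeasureWilsonTrace` — sectioned plaquette words with frozen exterior letters and the TRACE BOUND
# behind the LEVEL-0 ray-weight loss (S-ii)₀ of the Wilson block weight
# (cell `pub-balaban`, sub-cell `t4`, spine estimate NE7c (node U5b); lineage t4-ne7c-p1 = PROVER seat P1
# «shell-measure route», generation 25; file 2 of 3; ADDITIVE — imports `ShellMeasureWilsonWords` only)

HONEST FRAMING.  As in `ShellMeasureWilsonWords`: finite four-torus programme, rung (B)+1 only — NOT infinite volume,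
NOT a mass gap, NOT the Clay problem, NOT summit progress; (B), `BetaPertHyp`, (B^μ) not consumed.  (M1) for
Bałaban's inductively defined measures is NOT PRINTED (GAPS G-ne7cp1-1) and NOT moved.  This file supplies the
[folklore] algebra of the LEVEL-0 instance of (S-ii): 0 sorry, 0 citations.  HONEST DEPENDENCY (cell): continuum YM
on T⁴ ⇐ BetaPertH ∧ nine spine estimates (0/9 proved); BetaPertH ⇐ (D1) ∧ (D4) ∧ CAP+tail; G-an2-4 gates asym, D1 and
NE2/3/4.

THE POINT (§4).  A SECTIONED plaquette word is a list of LETTERS: frozen factors `a` (exterior bonds of the section,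
tree bonds; contractions, `‖a‖ ≤ 1`) and generators `Y` (block bonds, read as `exp(cY)` along the contraction;
`τ`-free and with contracting exponentials — `Letter.Good`).  For a TRACE DATUM `τ` («Re Tr»: real-additive,
real-homogeneous, `τ(ab) = τ(ba)`, `|τ a| ≤ N‖a‖` — `TraceData`) the two-sided TRACE INVARIANT
(`abs_trace_conj_sub_le`, induction on the word) gives for the word `G_w(c)` at contraction `c ∈ [0,1]`:
  `|τ(G_w(1) − G_w(c))| ≤ (1−c)·N·s(w)·(d(w) + 4 s(w))`     (`abs_trace_sub_le`),
`s(w) = Σ_gen ‖Y‖ ≤ 1`, `d(w) = Σ_frozen ‖a − 1‖`.  QUADRATIC in the small quantities: the first-order term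
`(1−c)·τ(Y·W)` of a generator is `(1−c)·τ(Y·(W − 1))` because `τ Y = 0` (skew-Hermitian generators), and the cyclic
conjugate `W` of the word is within `s + d` of `1`.  For an INTERIOR plaquette `d(w) = 0`: the Wilson energy
`1 − τ(G)/N` moves by `O((1−c)s²)` although the word itself moves by `O((1−c)s)`; for a BOUNDARY plaquette the
`d(w)`-term is the block's LINEAR RESPONSE TO THE FROZEN EXTERIOR — the located `ℓ_j` of GAPS G-ne7cp1-22, here a
number at level 0.  The packaging into the Wilson action's ray-weight loss and the assembly of (M1)₀ are in
`ShellMeasureWilsonBlock`.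

WHAT THIS DOES NOT DO.  Nothing about levels `j ≥ 1`; no Haar measure, no chart; NE7c NOT proved; 0/9 spine.
-/

noncomputable section

open NormedSpace Set

namespace Summit.QuantumFields.BalabanUV.T4Continuum.ShellMeasureWilsonTrace

open Literature.MathematicalPhysics.QuantumFieldTheory.Balaban1983to89
open T4ShellMeasurePlaquette (norm_exp_sub_one_le)
open ShellMeasureWilsonWords

/-! ## §4 Letters, sectioned words and the trace bound behind (S-ii)₀ -/

section Words

variable {A : Type*} [NormedRing A] [NormedAlgebra ℂ A] [CompleteSpace A] [NormOneClass A]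

/-- A LETTER of a sectioned plaquette word: a FROZEN factor `a` (an exterior bond variable of the section, or a
tree bond) or a GENERATOR `Y` (the Lie-algebra coordinate of a block bond, read as the factor `exp Y`, contracted to
`exp(cY)` along the ray). [folklore] -/
inductive Letter (A : Type*) where
  | frozen (a : A) : Letter A
  | gen (Y : A) : Letter A

namespace Letter

/-- the factor of a letter at contraction parameter `c`: `a`, resp. `exp(cY)`. [folklore] -/
def eval (c : ℝ) : Letter A → A
  | frozen a => a
  | gen Y => exp ((c : ℂ) • Y)

/-- the generator size of a letter: `0`, resp. `‖Y‖`. [folklore] -/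
def genNorm : Letter A → ℝ
  | frozen _ => 0
  | gen Y => ‖Y‖

/-- the frozen deviation of a letter: `‖a − 1‖`, resp. `0`. [folklore] -/
def dev : Letter A → ℝ
  | frozen a => ‖a - 1‖
  | gen _ => 0

/-- ADMISSIBILITY of a letter for a real functional `τ` («Re tr»): frozen factors are contractions (`‖a‖ ≤ 1` — unitary
exterior bonds in the operator norm); generators are `τ`-free (`τ Y = 0` — skew-Hermitian) with contracting
exponentials (`‖exp(cY)‖ ≤ 1`, `0 ≤ c ≤ 1` — unitary). [folklore] -/
def Good (τ : A → ℝ) : Letter A → Prop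
  | frozen a => ‖a‖ ≤ 1
  | gen Y => τ Y = 0 ∧ ∀ c : ℝ, 0 ≤ c → c ≤ 1 → ‖exp ((c : ℂ) • Y)‖ ≤ 1

omit [NormedAlgebra ℂ A] [CompleteSpace A] [NormOneClass A] in
/-- `genNorm ≥ 0`. [folklore] -/
theorem genNorm_nonneg (ℓ : Letter A) : 0 ≤ ℓ.genNorm := by
  cases ℓ with | frozen a => exact le_rfl | gen Y => exact norm_nonneg _

omit [NormedAlgebra ℂ A] [CompleteSpace A] [NormOneClass A] in
/-- `dev ≥ 0`. [folklore] -/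
theorem dev_nonneg (ℓ : Letter A) : 0 ≤ ℓ.dev := by
  cases ℓ with | frozen a => exact norm_nonneg _ | gen Y => exact le_rfl

omit [CompleteSpace A] [NormOneClass A] in
/-- an admissible letter is a contraction at every `0 ≤ c ≤ 1`. [folklore] -/
theorem norm_eval_le_one {τ : A → ℝ} {ℓ : Letter A} (hℓ : ℓ.Good τ) {c : ℝ} (hc0 : 0 ≤ c) (hc1 : c ≤ 1) :
    ‖ℓ.eval c‖ ≤ 1 := by
  cases ℓ with | frozen a => exact hℓ | gen Y => exact hℓ.2 c hc0 hc1

omit [NormOneClass A] in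
/-- the deviation of a letter from `1`: `‖eval_c ℓ − 1‖ ≤ dev ℓ + 3·genNorm ℓ` (`0 ≤ c ≤ 1`, `genNorm ℓ ≤ 1`).
[folklore] -/
theorem norm_eval_sub_one_le (ℓ : Letter A) {c : ℝ} (hc0 : 0 ≤ c) (hc1 : c ≤ 1) (hg : ℓ.genNorm ≤ 1) :
    ‖ℓ.eval c - 1‖ ≤ ℓ.dev + 3 * ℓ.genNorm := by
  cases ℓ with
  | frozen a => simp [eval, dev, genNorm]
  | gen Y =>
    simp only [eval, dev, genNorm, zero_add] at hg ⊢
    have h := norm_exp_sub_one_le ((c : ℂ) • Y)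
    rw [norm_real_smul hc0] at h
    have hct0 : 0 ≤ c * ‖Y‖ := mul_nonneg hc0 (norm_nonneg _)
    have hct1 : c * ‖Y‖ ≤ 1 := by nlinarith [norm_nonneg Y]
    have h2 := (exp_sub_one_le_pair hct0).2 hct1
    nlinarith [norm_nonneg Y]

omit [CompleteSpace A] [NormOneClass A] in
/-- frozen letters do not move along the ray. [folklore] -/
@[simp] theorem eval_frozen (a : A) (c : ℝ) :
    (frozen a : Letter A).eval c = a := rfl

omit [CompleteSpace A] [NormOneClass A] in
/-- generators move along the ray: `eval_c (gen Y) = exp(cY)`. [folklore] -/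
@[simp] theorem eval_gen (Y : A) (c : ℝ) : (gen Y : Letter A).eval c = exp ((c : ℂ) • Y) := rfl

end Letter

open Letter

/-- the sectioned word at contraction parameter `c`: the ordered product of its letters' factors. [folklore] -/
def wordEval (c : ℝ) (w : List (Letter A)) : A := (w.map (Letter.eval c)).prod

/-- `s(w) = Σ_{generators} ‖Y_i‖`. [folklore] -/
def sGen (w : List (Letter A)) : ℝ := (w.map Letter.genNorm).sum

/-- `d(w) = Σ_{frozen} ‖a_k − 1‖` — the frozen exterior's total deviation seen by the word. [folklore] -/
def dFro (w : List (Letter A)) : ℝ := (w.map Letter.dev).sum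

omit [NormedAlgebra ℂ A] [CompleteSpace A] [NormOneClass A] in
/-- `s([]) = 0`. [folklore] -/
@[simp] theorem sGen_nil : sGen ([] : List (Letter A)) = 0 := by simp [sGen]

omit [NormedAlgebra ℂ A] [CompleteSpace A] [NormOneClass A] in
/-- `s(ℓ :: w) = genNorm ℓ + s(w)`. [folklore] -/
@[simp] theorem sGen_cons (ℓ : Letter A) (w : List (Letter A)) : sGen (ℓ :: w) = ℓ.genNorm + sGen w := by
  simp [sGen]

omit [NormedAlgebra ℂ A] [CompleteSpace A] [NormOneClass A] in
/-- `d([]) = 0`. [folklore] -/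
@[simp] theorem dFro_nil : dFro ([] : List (Letter A)) = 0 := by simp [dFro]

omit [NormedAlgebra ℂ A] [CompleteSpace A] [NormOneClass A] in
/-- `d(ℓ :: w) = dev ℓ + d(w)`. [folklore] -/
@[simp] theorem dFro_cons (ℓ : Letter A) (w : List (Letter A)) : dFro (ℓ :: w) = ℓ.dev + dFro w := by
  simp [dFro]

omit [NormedAlgebra ℂ A] [CompleteSpace A] [NormOneClass A] in
/-- `s(w) ≥ 0`. [folklore] -/
theorem sGen_nonneg (w : List (Letter A)) : 0 ≤ sGen w :=
  List.sum_nonneg (by intro x hx; obtain ⟨ℓ, -, rfl⟩ := List.mem_map.1 hx; exact ℓ.genNorm_nonneg)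

omit [NormedAlgebra ℂ A] [CompleteSpace A] [NormOneClass A] in
/-- `d(w) ≥ 0`. [folklore] -/
theorem dFro_nonneg (w : List (Letter A)) : 0 ≤ dFro w :=
  List.sum_nonneg (by intro x hx; obtain ⟨ℓ, -, rfl⟩ := List.mem_map.1 hx; exact ℓ.dev_nonneg)

omit [CompleteSpace A] [NormOneClass A] in
/-- the empty word is `1`. [folklore] -/
@[simp] theorem wordEval_nil (c : ℝ) : wordEval c ([] : List (Letter A)) = 1 := by simp [wordEval]

omit [CompleteSpace A] [NormOneClass A] in
/-- `G_{ℓ::w}(c) = eval_c ℓ · G_w(c)`. [folklore] -/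
@[simp] theorem wordEval_cons (c : ℝ) (ℓ : Letter A) (w : List (Letter A)) :
    wordEval c (ℓ :: w) = ℓ.eval c * wordEval c w := by simp [wordEval]

omit [NormedAlgebra ℂ A] [CompleteSpace A] [NormOneClass A] in
/-- the elementary deviation rule `‖g₁g₂ − 1‖ ≤ ‖g₁ − 1‖ + ‖g₂ − 1‖` for a contraction `g₁` (B7 (19)'s
`|UV − 1| ≤ |U − 1| + |V − 1|` in any normed ring). [folklore] -/
theorem norm_mul_sub_one_le {g₁ g₂ : A} (h₁ : ‖g₁‖ ≤ 1) : ‖g₁ * g₂ - 1‖ ≤ ‖g₁ - 1‖ + ‖g₂ - 1‖ := by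
  have e : g₁ * g₂ - 1 = g₁ * (g₂ - 1) + (g₁ - 1) := by noncomm_ring
  rw [e]
  calc ‖g₁ * (g₂ - 1) + (g₁ - 1)‖ ≤ ‖g₁ * (g₂ - 1)‖ + ‖g₁ - 1‖ := norm_add_le _ _
    _ ≤ ‖g₁‖ * ‖g₂ - 1‖ + ‖g₁ - 1‖ := by gcongr; exact norm_mul_le _ _
    _ ≤ 1 * ‖g₂ - 1‖ + ‖g₁ - 1‖ := by gcongr
    _ = ‖g₁ - 1‖ + ‖g₂ - 1‖ := by ring

omit [CompleteSpace A] in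
/-- an admissible word is a contraction. [folklore] -/
theorem norm_wordEval_le_one {τ : A → ℝ} : ∀ {w : List (Letter A)}, (∀ ℓ ∈ w, ℓ.Good τ) →
    ∀ {c : ℝ}, 0 ≤ c → c ≤ 1 → ‖wordEval c w‖ ≤ 1
  | [], _, _, _, _ => by simp
  | ℓ :: w, hw, c, hc0, hc1 => by
    rw [wordEval_cons]
    have h1 := norm_eval_le_one (hw ℓ (by simp)) hc0 hc1
    have h2 := norm_wordEval_le_one (fun ℓ' hℓ' => hw ℓ' (List.mem_cons_of_mem _ hℓ')) hc0 hc1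
    calc ‖ℓ.eval c * wordEval c w‖ ≤ ‖ℓ.eval c‖ * ‖wordEval c w‖ := norm_mul_le _ _
      _ ≤ 1 * 1 := mul_le_mul h1 h2 (norm_nonneg _) zero_le_one
      _ = 1 := one_mul _

omit [NormOneClass A] in
/-- the deviation of an admissible word from `1`: `‖G_w(c) − 1‖ ≤ d(w) + 3·s(w)` (`s(w) ≤ 1`). [folklore] -/
theorem norm_wordEval_sub_one_le {τ : A → ℝ} : ∀ {w : List (Letter A)}, (∀ ℓ ∈ w, ℓ.Good τ) → sGen w ≤ 1 →
    ∀ {c : ℝ}, 0 ≤ c → c ≤ 1 → ‖wordEval c w - 1‖ ≤ dFro w + 3 * sGen w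
  | [], _, _, _, _, _ => by simp
  | ℓ :: w, hw, hs, c, hc0, hc1 => by
    rw [sGen_cons] at hs
    have hσ0 := sGen_nonneg w
    have hg0 := ℓ.genNorm_nonneg
    rw [wordEval_cons, sGen_cons, dFro_cons]
    have h1 := norm_eval_sub_one_le ℓ hc0 hc1 (by linarith)
    have h2 := norm_wordEval_sub_one_le (fun ℓ' hℓ' => hw ℓ' (List.mem_cons_of_mem _ hℓ')) (by linarith) hc0 hc1
    have h3 := norm_mul_sub_one_le (g₂ := wordEval c w) (norm_eval_le_one (hw ℓ (by simp)) hc0 hc1)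
    linarith

/-- A TRACE-LIKE FUNCTIONAL: a real-additive, real-homogeneous `τ : A → ℝ` with the trace property
`τ(ab) = τ(ba)` and the operator bound `|τ a| ≤ N‖a‖` (the model: `τ = Re Tr` on `M_N(ℂ)` in the operator norm).
[folklore] -/
structure TraceData (A : Type*) [NormedRing A] [NormedAlgebra ℂ A] where
  /-- the functional («Re Tr») -/
  τ : A → ℝ
  /-- the operator-norm constant («N») -/
  N : ℝ
  map_add : ∀ a b, τ (a + b) = τ a + τ b
  map_smul : ∀ (r : ℝ) a, τ ((r : ℂ) • a) = r * τ a
  comm : ∀ a b, τ (a * b) = τ (b * a)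
  abs_le : ∀ a, |τ a| ≤ N * ‖a‖

namespace TraceData

variable (T : TraceData A)

omit [CompleteSpace A] [NormOneClass A] in
/-- `τ 0 = 0`. [folklore] -/
theorem map_zero : T.τ 0 = 0 := by
  have h := T.map_add 0 0; rw [add_zero] at h; linarith

omit [CompleteSpace A] [NormOneClass A] in
/-- `τ(−a) = −τ a`. [folklore] -/
theorem map_neg (a : A) : T.τ (-a) = -T.τ a := by
  have h := T.map_add a (-a); rw [add_neg_cancel, T.map_zero] at h; linarith

omit [CompleteSpace A] [NormOneClass A] in
/-- `τ(a − b) = τ a − τ b`. [folklore] -/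
theorem map_sub (a b : A) : T.τ (a - b) = T.τ a - T.τ b := by
  rw [sub_eq_add_neg, T.map_add, T.map_neg]; ring

end TraceData

omit [CompleteSpace A] in
/-- with `‖1‖ = 1`: `0 ≤ N` (from `|τ 1| ≤ N‖1‖`). [folklore] -/
theorem TraceData.N_nonneg (T : TraceData A) : 0 ≤ T.N := by
  have h1 := T.abs_le 1; rw [norm_one, mul_one] at h1; exact (abs_nonneg _).trans h1

/-- THE GENERATOR STEP of the trace invariant: for an admissible generator `Y` (`τ Y = 0`, contracting
exponentials, `‖Y‖ ≤ 1`), contractions `Gc, P, S` with `‖Gc·(S·P) − 1‖ ≤ D`, and `0 ≤ c ≤ 1`: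
`|τ(P·((e^{Y} − e^{cY})·Gc)·S)| ≤ (1−c)·N·(‖Y‖·(3c‖Y‖ + D) + ‖Y‖²)`.  Mechanism: `e^Y − e^{cY} = (e^{(1−c)Y} − 1)e^{cY}`;
the trace property moves `P` to the back, `W = e^{cY}·Gc·S·P` is a contraction within `3c‖Y‖ + D` of `1`;
`e^{(1−c)Y} − 1 = (1−c)Y + r`, `‖r‖ ≤ ((1−c)‖Y‖)²`; `τ(YW) = τ(Y(W − 1))` since `τ Y = 0`. [folklore] -/
theorem abs_trace_genStep_le (T : TraceData A) {Y : A} (hτY : T.τ Y = 0)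
    (hU : ∀ c : ℝ, 0 ≤ c → c ≤ 1 → ‖exp ((c : ℂ) • Y)‖ ≤ 1) (hY1 : ‖Y‖ ≤ 1) {c : ℝ} (hc0 : 0 ≤ c) (hc1 : c ≤ 1)
    {Gc P S : A} (hGc : ‖Gc‖ ≤ 1) (hP : ‖P‖ ≤ 1) (hS : ‖S‖ ≤ 1) {D : ℝ} (hGSP : ‖Gc * (S * P) - 1‖ ≤ D) :
    |T.τ (P * ((exp Y - exp ((c : ℂ) • Y)) * Gc) * S)| ≤
      (1 - c) * T.N * (‖Y‖ * (3 * (c * ‖Y‖) + D) + ‖Y‖ ^ 2) := by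
  have hN0 := T.N_nonneg
  have h1c : 0 ≤ 1 - c := by linarith
  have ht0 : 0 ≤ ‖Y‖ := norm_nonneg _
  have hgcn : ‖exp ((c : ℂ) • Y)‖ ≤ 1 := hU c hc0 hc1
  -- `e^Y − e^{cY} = (e^{(1−c)Y} − 1)·e^{cY}`
  have hsplit : exp Y - exp ((c : ℂ) • Y) = (exp (((1 - c : ℝ) : ℂ) • Y) - 1) * exp ((c : ℂ) • Y) := by
    rw [exp_eq_exp_smul_mul_exp_smul Y (by ring : (1 - c) + c = 1)]
    noncomm_ring
  -- move `P` to the back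
  have hcyc : T.τ (P * ((exp Y - exp ((c : ℂ) • Y)) * Gc) * S) =
      T.τ ((exp (((1 - c : ℝ) : ℂ) • Y) - 1) * (exp ((c : ℂ) • Y) * Gc * S * P)) := by
    rw [hsplit, mul_assoc P, T.comm P]
    congr 1; noncomm_ring
  -- the contraction `W` and its deviation
  have hWn : ‖exp ((c : ℂ) • Y) * Gc * S * P‖ ≤ 1 := by
    calc ‖exp ((c : ℂ) • Y) * Gc * S * P‖ ≤ ‖exp ((c : ℂ) • Y) * Gc * S‖ * ‖P‖ := norm_mul_le _ _
      _ ≤ (‖exp ((c : ℂ) • Y) * Gc‖ * ‖S‖) * ‖P‖ := by gcongr; exact norm_mul_le _ _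
      _ ≤ ((‖exp ((c : ℂ) • Y)‖ * ‖Gc‖) * ‖S‖) * ‖P‖ := by gcongr; exact norm_mul_le _ _
      _ ≤ ((1 * 1) * 1) * 1 := by gcongr
      _ = 1 := by norm_num
  have hgc1 : ‖exp ((c : ℂ) • Y) - 1‖ ≤ 3 * (c * ‖Y‖) := by
    have h := norm_exp_sub_one_le ((c : ℂ) • Y)
    rw [norm_real_smul hc0] at h
    exact h.trans ((exp_sub_one_le_pair (by positivity)).2 (by nlinarith))
  have hW1 : ‖exp ((c : ℂ) • Y) * Gc * S * P - 1‖ ≤ 3 * (c * ‖Y‖) + D := by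
    rw [mul_assoc (exp ((c : ℂ) • Y) * Gc), mul_assoc (exp ((c : ℂ) • Y))]
    exact (norm_mul_sub_one_le hgcn).trans (add_le_add hgc1 hGSP)
  -- first-order decomposition of `e^{(1−c)Y} − 1`
  have hrn : ‖exp (((1 - c : ℝ) : ℂ) • Y) - 1 - ((1 - c : ℝ) : ℂ) • Y‖ ≤ ((1 - c) * ‖Y‖) ^ 2 :=
    norm_exp_smul_sub_one_sub_le Y h1c (by nlinarith)
  have hdecomp : (exp (((1 - c : ℝ) : ℂ) • Y) - 1) * (exp ((c : ℂ) • Y) * Gc * S * P) =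
      ((1 - c : ℝ) : ℂ) • (Y * (exp ((c : ℂ) • Y) * Gc * S * P - 1)) + ((1 - c : ℝ) : ℂ) • Y +
        (exp (((1 - c : ℝ) : ℂ) • Y) - 1 - ((1 - c : ℝ) : ℂ) • Y) * (exp ((c : ℂ) • Y) * Gc * S * P) := by
    simp only [mul_sub, sub_mul, smul_sub, smul_mul_assoc, mul_one]; abel
  rw [hcyc, hdecomp, T.map_add, T.map_add, T.map_smul, T.map_smul, hτY, mul_zero, add_zero]
  have hb1 : |T.τ (Y * (exp ((c : ℂ) • Y) * Gc * S * P - 1))| ≤ T.N * (‖Y‖ * (3 * (c * ‖Y‖) + D)) := by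
    refine (T.abs_le _).trans (mul_le_mul_of_nonneg_left ?_ hN0)
    exact (norm_mul_le _ _).trans (mul_le_mul_of_nonneg_left hW1 ht0)
  have hb2 : |T.τ ((exp (((1 - c : ℝ) : ℂ) • Y) - 1 - ((1 - c : ℝ) : ℂ) • Y) * (exp ((c : ℂ) • Y) * Gc * S * P))| ≤
      T.N * ((1 - c) * ‖Y‖ ^ 2) := by
    refine (T.abs_le _).trans (mul_le_mul_of_nonneg_left ?_ hN0)
    refine (norm_mul_le _ _).trans ?_
    calc ‖exp (((1 - c : ℝ) : ℂ) • Y) - 1 - ((1 - c : ℝ) : ℂ) • Y‖ * ‖exp ((c : ℂ) • Y) * Gc * S * P‖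
        ≤ ((1 - c) * ‖Y‖) ^ 2 * 1 := mul_le_mul hrn hWn (norm_nonneg _) (by positivity)
      _ ≤ (1 - c) * ‖Y‖ ^ 2 := by nlinarith [mul_nonneg (mul_nonneg hc0 h1c) (sq_nonneg ‖Y‖)]
  calc |(1 - c) * T.τ (Y * (exp ((c : ℂ) • Y) * Gc * S * P - 1)) +
          T.τ ((exp (((1 - c : ℝ) : ℂ) • Y) - 1 - ((1 - c : ℝ) : ℂ) • Y) * (exp ((c : ℂ) • Y) * Gc * S * P))|
      ≤ |(1 - c) * T.τ (Y * (exp ((c : ℂ) • Y) * Gc * S * P - 1))| +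
          |T.τ ((exp (((1 - c : ℝ) : ℂ) • Y) - 1 - ((1 - c : ℝ) : ℂ) • Y) * (exp ((c : ℂ) • Y) * Gc * S * P))| :=
        abs_add_le _ _
    _ = (1 - c) * |T.τ (Y * (exp ((c : ℂ) • Y) * Gc * S * P - 1))| +
          |T.τ ((exp (((1 - c : ℝ) : ℂ) • Y) - 1 - ((1 - c : ℝ) : ℂ) • Y) * (exp ((c : ℂ) • Y) * Gc * S * P))| := by
        rw [abs_mul, abs_of_nonneg h1c]
    _ ≤ (1 - c) * (T.N * (‖Y‖ * (3 * (c * ‖Y‖) + D))) + T.N * ((1 - c) * ‖Y‖ ^ 2) := by gcongr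
    _ = (1 - c) * T.N * (‖Y‖ * (3 * (c * ‖Y‖) + D) + ‖Y‖ ^ 2) := by ring

/-- **THE TRACE INVARIANT** (induction on the word, two-sided).  For an admissible word `w` with `s(w) ≤ 1`,
`0 ≤ c ≤ 1`, and contractions `P, S`:
`|τ(P·(G_w(1) − G_w(c))·S)| ≤ (1−c)·N·s(w)·(d(w) + ‖SP − 1‖ + 4 s(w))`.
Mechanism: telescoping `g₁G₁ − g_cG_c = g₁(G₁ − G_c) + (g₁ − g_c)G_c`; a frozen letter has `g₁ = g_c`; a generator
contributes the step `abs_trace_genStep_le`. [folklore] -/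
theorem abs_trace_conj_sub_le (T : TraceData A) {w : List (Letter A)} (hw : ∀ ℓ ∈ w, ℓ.Good T.τ)
    (hs : sGen w ≤ 1) {c : ℝ} (hc0 : 0 ≤ c) (hc1 : c ≤ 1) :
    ∀ (P S : A), ‖P‖ ≤ 1 → ‖S‖ ≤ 1 →
      |T.τ (P * (wordEval 1 w - wordEval c w) * S)| ≤
        (1 - c) * T.N * sGen w * (dFro w + ‖S * P - 1‖ + 4 * sGen w) := by
  have hN0 := T.N_nonneg
  have h1c : 0 ≤ 1 - c := by linarith
  induction w with
  | nil => intro P S _ _; simp [T.map_zero]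
  | cons ℓ w ih =>
    intro P S hP hS
    have hw' : ∀ ℓ' ∈ w, ℓ'.Good T.τ := fun ℓ' hℓ' => hw ℓ' (List.mem_cons_of_mem _ hℓ')
    have hℓ : ℓ.Good T.τ := hw ℓ (by simp)
    rw [sGen_cons] at hs
    have hσ0 := sGen_nonneg w
    have hd0 := dFro_nonneg w
    have hg0 := ℓ.genNorm_nonneg
    have hdv0 := ℓ.dev_nonneg
    have hσ1 : sGen w ≤ 1 := by linarith
    replace ih := ih hw' hσ1
    rw [wordEval_cons, wordEval_cons, sGen_cons, dFro_cons]
    -- norms of the players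
    have hg₁n : ‖ℓ.eval 1‖ ≤ 1 := norm_eval_le_one hℓ zero_le_one le_rfl
    have hGcn : ‖wordEval c w‖ ≤ 1 := norm_wordEval_le_one hw' hc0 hc1
    have hGc1 : ‖wordEval c w - 1‖ ≤ dFro w + 3 * sGen w := norm_wordEval_sub_one_le hw' hσ1 hc0 hc1
    have hg₁1 : ‖ℓ.eval 1 - 1‖ ≤ ℓ.dev + 3 * ℓ.genNorm := norm_eval_sub_one_le ℓ zero_le_one le_rfl (by linarith)
    have hSP : ‖S * P‖ ≤ 1 := (norm_mul_le _ _).trans (by nlinarith [norm_nonneg S, norm_nonneg P])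
    -- telescoping
    have split : P * (ℓ.eval 1 * wordEval 1 w - ℓ.eval c * wordEval c w) * S =
        (P * ℓ.eval 1) * (wordEval 1 w - wordEval c w) * S + P * ((ℓ.eval 1 - ℓ.eval c) * wordEval c w) * S := by
      noncomm_ring
    rw [split, T.map_add]
    -- first term: the induction hypothesis with the contraction `P·g₁`
    have hPg : ‖P * ℓ.eval 1‖ ≤ 1 := (norm_mul_le _ _).trans (by nlinarith [norm_nonneg P, norm_nonneg (ℓ.eval 1)])
    have hq' : ‖S * (P * ℓ.eval 1) - 1‖ ≤ ‖S * P - 1‖ + (ℓ.dev + 3 * ℓ.genNorm) := by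
      rw [← mul_assoc]
      exact (norm_mul_sub_one_le hSP).trans (add_le_add le_rfl hg₁1)
    have first : |T.τ (P * ℓ.eval 1 * (wordEval 1 w - wordEval c w) * S)| ≤
        (1 - c) * T.N * sGen w * (dFro w + (‖S * P - 1‖ + (ℓ.dev + 3 * ℓ.genNorm)) + 4 * sGen w) := by
      refine (ih (P * ℓ.eval 1) S hPg hS).trans ?_
      have hfac : 0 ≤ (1 - c) * T.N * sGen w := by positivity
      nlinarith [hq']
    -- second term
    cases ℓ with
    | frozen a =>
      have hz : (Letter.frozen a : Letter A).eval 1 - (Letter.frozen a).eval c = 0 := by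
        rw [eval_frozen, eval_frozen, sub_self]
      rw [hz, zero_mul, mul_zero, zero_mul, T.map_zero, add_zero]
      simp only [Letter.dev, Letter.genNorm] at first ⊢
      refine first.trans (le_of_eq ?_)
      ring
    | gen Y =>
      have e1 : (Letter.gen Y : Letter A).eval 1 = exp Y := by simp [Letter.eval]
      rw [e1] at first
      rw [e1, eval_gen]
      simp only [Letter.dev, Letter.genNorm, zero_add] at first hs hg0 ⊢
      obtain ⟨hτY, hU⟩ := hℓ
      have hY1 : ‖Y‖ ≤ 1 := by linarith
      have hGSP : ‖wordEval c w * (S * P) - 1‖ ≤ (dFro w + 3 * sGen w) + ‖S * P - 1‖ :=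
        (norm_mul_sub_one_le hGcn).trans (add_le_add hGc1 le_rfl)
      have second := abs_trace_genStep_le T hτY hU hY1 hc0 hc1 hGcn hP hS hGSP
      refine (abs_add_le _ _).trans ((add_le_add first second).trans ?_)
      have hf : 0 ≤ (1 - c) * T.N := mul_nonneg h1c hN0
      nlinarith [mul_nonneg hf (mul_nonneg hg0 hσ0), mul_nonneg hf (sq_nonneg ‖Y‖),
        mul_nonneg (mul_nonneg hf hg0) (mul_nonneg hc0 hg0), mul_nonneg hc0 hg0]

/-- **THE TRACE BOUND FOR ONE SECTIONED PLAQUETTE WORD** (the invariant at `P = S = 1`):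
`|τ(G_w(1) − G_w(c))| ≤ (1−c)·N·s(w)·(d(w) + 4 s(w))` — quadratic in the small quantities `s(w)` (the block's
generators on `∂p`) and `d(w)` (the frozen exterior's deviation on `∂p`); for an INTERIOR plaquette `d(w) = 0`.
[folklore] -/
theorem abs_trace_sub_le (T : TraceData A) {w : List (Letter A)} (hw : ∀ ℓ ∈ w, ℓ.Good T.τ) (hs : sGen w ≤ 1)
    {c : ℝ} (hc0 : 0 ≤ c) (hc1 : c ≤ 1) :
    |T.τ (wordEval 1 w - wordEval c w)| ≤ (1 - c) * T.N * sGen w * (dFro w + 4 * sGen w) := by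
  have h := abs_trace_conj_sub_le T hw hs hc0 hc1 1 1 (le_of_eq norm_one) (le_of_eq norm_one)
  simpa using h

end Words

end Summit.QuantumFields.BalabanUV.T4Continuum.ShellMeasureWilsonTrace
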